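import Mathlib
import Summits.ResolutionOfSingularities.ResolutionOfSingularities.Theorems.PAlterationPicoverLocalModelLocalChartsKummerCentre
import Summits.ResolutionOfSingularities.ResolutionOfSingularities.Theorems.PAlterationPicoverLocalChartSepWoundCentre
import Summits.ResolutionOfSingularities.ResolutionOfSingularities.Theorems.PAlterationPicoverPointDataPointwise
import HarnessLib

/-!
# Crux `Picover` (stmt-ResolutionOfSingularities-0554), line `giraud-separated-base` — endgame,
# local charts of the normalised cover: the chart at a point over a Kummer centre

Stub `localChartSep_kummerCentre` (wave 5, U5) of the registered stub `stub_localChartsSep`.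

**Setting.** `W'` a regular integral scheme locally of finite type over a field `k` of
characteristic `p`, `E` an snc boundary on `W'`, `U₀ ⊆ W'` an affine open and
`a ∈ Γ(W', U₀)` a section whose germ at every point of `U₀` is in Giraud normal form along
`E`; `g : Z → W'` a morphism from an integral scheme (in the application, the normalisation of
`W'` in a purely inseparable extension of degree `p` of its function field) which, over every
affine `V ⊆ U₀` with `g⁻¹V ≠ ∅`, carries the "uniform sections package": `g⁻¹V` is affine,
`B = Γ(Z, g⁻¹V)` is integrally closed and integral over `A = Γ(W', V)` with injective structure
map, and every element of `B` is, up to a non-zero denominator from `A`, a polynomial over `A`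
in a `p`-th root `t ∈ B` of `a|_V`.

**Claim.** At a point `y ∈ Z` whose image `w = g(y) ∈ U₀` is a Kummer centre of the normal
form (`a_w = g₀^p + v₀ ∏ x_j^{A_j}` with `v₀` a unit and `p ∤ A_{j₀}`, `x_j` generators of the
stalk ideals of the components of `E` through `w`), there is a local log-regular chart of `Z`
at `y` (Kato's condition (2.1) at every prime of the chart ring) whose stalk monoids are the
divisorial monoids of the pulled-back boundary `(∏_{D ∈ E} D_{g(y')}) 𝒪_{Z,y'}`.

**Proof.** This is `PicoverLocalModel.LocalCharts.localChart_kummerCentre` (crux 0557) for an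
abstract cover: spread the centre data (`x_j`, `g₀`, `v₀`, `v₀⁻¹`) to an affine open `U ∋ w`
contained in `U₀` (`LocalChartSepWoundCentre.exists_affineOpen_spread_le`; the spread `vs` of
`v₀` is a unit of `Γ(W', U)` because `vs · (spread of v₀⁻¹)` has germ `1` at `w` and germs are
injective on an integral scheme), so that `a` restricts to `aU = gs^p + vs ∏ xs_j^{A_j}` in
`A = Γ(W', U)`; twist (`xs_{j₀} ↦ vs^{c₀} xs_{j₀}` with `c₀ A_{j₀} ≡ 1 mod p`, so that
`aU - gs^p = u₁^p ∏ xs'_j^{A_j}` with `u₁` a unit); take `V = g⁻¹U`, the sections package over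
`U` and the Kummer chart `Φ : kummerCone p j₀ c → Γ(Z, V)` built from the `p`-th root `t`
(`exists_kummerChart`); Kato's condition at every prime of `Γ(Z, V)` and the stalk monoids at
every point of `V` follow from `localChart_pointwise_kummer`, the Giraud normal form at the
other points of `U` being read off the pointwise hypothesis by
`Picover.PointDataPointwise.pointData_giraudNormalFormAt_of_pointwise`.
-/

noncomputable section

-- single-problem summit: the doubled namespace component `ResolutionOfSingularities` is the tree layout
set_option linter.dupNamespace false

open CategoryTheory AlgebraicGeometry TopologicalSpace Polynomial IsLocalRing
open Literature.AlgebraicGeometry.Resolution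
open Summit.ResolutionOfSingularities.ResolutionOfSingularities.Theorems.PicoverLocalModel.LocalCharts
open Summit.ResolutionOfSingularities.ResolutionOfSingularities.Theorems.Picover.PointDataPointwise
open Summit.ResolutionOfSingularities.ResolutionOfSingularities.Theorems.Picover.LocalChartSepWoundCentre

namespace Summit.ResolutionOfSingularities.ResolutionOfSingularities.Theorems.Picover.LocalChartSepKummerCentre

/-- **The local chart at a point over a Kummer centre, for an abstract cover with a uniform
sections package.** See the module docstring. [cite: Kato1994, Def. (2.1) and Thm. 11.6] -/
theorem localChartSep_kummerCentre : ∀ (p : ℕ) [Fact p.Prime] (k : Type) [Field k] [CharP k p] (W' : Scheme.{0}) (f' : W' ⟶ Spec (.of k)) [LocallyOfFiniteType f'] [IsIntegral W'], Scheme.IsRegular W' → ∀ (E : List W'.IdealSheafData), HasSNC E → ∀ (U₀ : W'.affineOpens) (a : Γ(W', (U₀ : W'.Opens))), (∀ (w'' : W') (hw'' : w'' ∈ (U₀ : W'.Opens)), ∃ (r : ℕ) (D : Fin r → {D : W'.IdealSheafData // D ∈ E ∧ w'' ∈ D.support}) (x : Fin r → W'.presheaf.stalk w''), Function.Bijective D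 ∧ (∀ j, stalkIdeal (D j).1 w'' = Ideal.span {x j}) ∧ GiraudNormalFormAt p x (W'.presheaf.germ (U₀ : W'.Opens) w'' hw'' a)) → ∀ (Z : Scheme.{0}) [IsIntegral Z] (g : Z ⟶ W'), (∀ (V : W'.affineOpens) (hV : (V : W'.Opens) ≤ U₀), Nonempty (g ⁻¹ᵁ (V : W'.Opens)) → IsAffineOpen (g ⁻¹ᵁ (V : W'.Opens)) ∧ IsIntegrallyClosed Γ(Z, g ⁻¹ᵁ (V : W'.Opens)) ∧ (g.app (V : W'.Opens)).hom.IsIntegral ∧ Function.Injective (g.app (V : W'.Opens)) ∧ ∃ t : Γ(Z, g ⁻¹ᵁ (V : W'.Opens)), t ^ p = g.app (V : W'.Opens) (W'.presheaf.map (homOfLE hV).op a) ∧ ∀ z : Γ(Z, g ⁻¹ᵁ (V : W'.Opens)), ∃ d : Γ(W', (V : W'.Opens)), d ≠ 0 ∧ ∃ P : Γ(W', (V : W'.Opens))[X], g.app (V : W'.Opens) d * z = P.eval₂ (g.app (V : W'.Opens)).hom t) → ∀ (y : Z) (w : W') (hw : g.base y = w) (hwU₀ : w ∈ (U₀ : W'.Opens))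 {r : ℕ} (D : Fin r → {D : W'.IdealSheafData // D ∈ E ∧ w ∈ D.support}) (x : Fin r → W'.presheaf.stalk w), Function.Bijective D → (∀ j, stalkIdeal (D j).1 w = Ideal.span {x j}) → ∀ (g₀ : W'.presheaf.stalk w) (Aexp : Fin r → ℕ) (v₀ : (W'.presheaf.stalk w)ˣ) (j₀ : Fin r), ¬ p ∣ Aexp j₀ → W'.presheaf.germ (U₀ : W'.Opens) w hwU₀ a = g₀ ^ p + (v₀ : W'.presheaf.stalk w) * ∏ j, x j ^ Aexp j → Nonempty (LocalLogRegularChart Z (fun y => divisorialMonoid (((E.map fun D => stalkIdeal D (g.base y))).prod.map (g.stalkMap y).hom)) y) := by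
  intro p _ k _ _ W' f' _ _ hreg E hE U₀ a hG Z _ g hsecZ y w hw hwU₀ r D x hDbij hDgen g₀ Aexp v₀ j₀ hj₀ ha₀
  classical
  have hp : p.Prime := Fact.out
  haveI : IsLocallyNoetherian W' := LocallyOfFiniteType.isLocallyNoetherian f'
  -- the centre
  haveI hregw : IsRegularLocalRing (W'.presheaf.stalk w) := hreg w
  haveI := isDomain_of_isRegularLocalRing (W'.presheaf.stalk w)
  obtain ⟨hxm, hli⟩ := hli_of_hasSNC hE w D hDbij.1 x hDgen
  have hxprime : ∀ j, (Ideal.span {x j}).IsPrime := RegularParameters.isPrime_span_singleton hxm hli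
  have hx0 : ∀ j, x j ≠ 0 := fun j h0 => RegularParameters.notMem_sq hli j (h0 ▸ Ideal.zero_mem _)
  -- spread to an affine open `w ∈ U ⊆ U₀`
  obtain ⟨U, hwU, hUU₀, xs, fs, hxs, hfs, hB1, hB2, hprime⟩ :=
    exists_affineOpen_spread_le E w D (fun D' hD' hsupp => hDbij.2 ⟨D', hD', hsupp⟩ |>.imp
      fun j hj => congrArg Subtype.val hj) x hDgen hxprime
      ![g₀, (v₀ : W'.presheaf.stalk w), ((v₀⁻¹ : (W'.presheaf.stalk w)ˣ) : W'.presheaf.stalk w)]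
      (U₀ : W'.Opens) hwU₀
  set gs := fs 0 with hgs
  set vs := fs 1 with hvs
  -- the spread of the unit `v₀` is a unit: `vs * fs 2` has germ `v₀ v₀⁻¹ = 1` at `w`
  have hvsu : IsUnit vs := by
    refine IsUnit.of_mul_eq_one (fs 2) ?_
    apply germ_injective_of_isIntegral (X := W') w hwU
    rw [map_mul, map_one, hvs, hfs 1, hfs 2]
    exact v₀.mul_inv
  -- sections of the cover over `U`
  have hyV : y ∈ g ⁻¹ᵁ (U : W'.Opens) := by
    change g.base y ∈ (U : W'.Opens); rw [hw]; exact hwU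
  obtain ⟨hVaff, hic, hint, hinj, t, ht, hbir⟩ := hsecZ U hUU₀ ⟨⟨y, hyV⟩⟩
  -- the radicand on `U`
  set aU : Γ(W', (U : W'.Opens)) := W'.presheaf.map (homOfLE hUU₀).op a with haU
  have hgerm_aU : ∀ (w'' : W') (hw'' : w'' ∈ (U : W'.Opens)),
      W'.presheaf.germ (U : W'.Opens) w'' hw'' aU =
        W'.presheaf.germ (U₀ : W'.Opens) w'' (hUU₀ hw'') a :=
    fun w'' hw'' => germ_map_homOfLE hUU₀ w'' hw'' a
  -- the pointwise Giraud normal form of `aU` on `U`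
  have hG' : ∀ (w'' : W') (hw'' : w'' ∈ (U : W'.Opens)), ∃ (r' : ℕ)
      (D' : Fin r' → {D : W'.IdealSheafData // D ∈ E ∧ w'' ∈ D.support})
      (x' : Fin r' → W'.presheaf.stalk w''), Function.Bijective D' ∧
      (∀ i, stalkIdeal (D' i).1 w'' = Ideal.span {x' i}) ∧
      GiraudNormalFormAt p x' (W'.presheaf.germ (U : W'.Opens) w'' hw'' aU) := fun w'' hw'' => by
    rw [hgerm_aU w'' hw'']
    exact hG w'' (hUU₀ hw'')
  -- the identity in `A = Γ(W', U)`
  have hA : aU = gs ^ p + vs * ∏ j, xs j ^ Aexp j := by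
    apply germ_injective_of_isIntegral (X := W') w hwU
    rw [hgerm_aU w hwU, ha₀, map_add, map_pow, map_mul, map_prod]
    simp only [map_pow, hxs, hgs, hvs, hfs]
    rfl
  -- the Kummer twist
  obtain ⟨c₀, hc₀⟩ := exists_mul_mod_eq_one (p := p) hj₀
  set m₀ : ℕ := c₀ * Aexp j₀ / p with hm₀def
  have hm₀ : c₀ * Aexp j₀ = p * m₀ + 1 := by
    have := Nat.div_add_mod (c₀ * Aexp j₀) p
    rw [hc₀] at this; rw [hm₀def]; exact this.symm
  let xs' : Fin r → Γ(W', (U : W'.Opens)) := fun j => if j = j₀ then vs ^ c₀ * xs j else xs j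
  let u₁ : Γ(W', (U : W'.Opens)) := ↑(hvsu.unit⁻¹) ^ m₀
  have hu₁ : IsUnit u₁ := (Units.isUnit _).pow _
  have hA' : aU - gs ^ p = u₁ ^ p * ∏ j, xs' j ^ Aexp j := by
    have h1 : ∏ j, xs' j ^ Aexp j = vs ^ (c₀ * Aexp j₀) * ∏ j, xs j ^ Aexp j := by
      have : ∀ j, xs' j ^ Aexp j = (if j = j₀ then vs ^ c₀ else 1) ^ Aexp j * xs j ^ Aexp j := by
        intro j; simp only [xs']; split_ifs <;> ring
      rw [Finset.prod_congr rfl fun j _ => this j, Finset.prod_mul_distrib]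
      congr 1
      rw [Finset.prod_eq_single j₀ (fun j _ hj => by simp [hj]) (by simp)]
      simp [pow_mul]
    rw [h1, hm₀, hA]
    have hvinv : (↑(hvsu.unit⁻¹) : Γ(W', (U : W'.Opens))) * vs = 1 := hvsu.val_inv_mul
    calc gs ^ p + vs * ∏ j, xs j ^ Aexp j - gs ^ p = vs * ∏ j, xs j ^ Aexp j := by ring
      _ = vs * ((↑(hvsu.unit⁻¹) : Γ(W', (U : W'.Opens))) * vs) ^ (p * m₀) *
            ∏ j, xs j ^ Aexp j := by
          rw [hvinv, one_pow, mul_one]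
      _ = u₁ ^ p * (vs ^ (p * m₀ + 1) * ∏ j, xs j ^ Aexp j) := by simp only [u₁]; ring
  have hB1' : ∀ j, (D j).1.ideal U = Ideal.span {xs' j} := by
    intro j
    rw [hB1 j]
    simp only [xs']
    split_ifs
    · exact (Ideal.span_singleton_mul_left_unit (hvsu.pow c₀) (xs j)).symm
    · rfl
  have hprime' : ∀ j, (Ideal.span {xs' j}).IsPrime := fun j => by
    rw [← hB1' j, hB1 j]; exact hprime j
  have hxs0 : ∀ j, xs' j ≠ 0 := by
    intro j h0
    have : xs j = 0 := by
      simp only [xs'] at h0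
      split_ifs at h0 with hj
      · exact ((hvsu.pow c₀).mul_right_eq_zero).mp h0
      · exact h0
    apply hx0 j
    rw [← hxs j, this, map_zero]
  -- the algebra `A = Γ(W', U) → B = Γ(Z, g⁻¹U)`
  haveI : Nonempty (g ⁻¹ᵁ (U : W'.Opens)) := ⟨⟨y, hyV⟩⟩
  haveI : Nonempty (U : W'.Opens) := ⟨⟨w, hwU⟩⟩
  letI algAB : Algebra Γ(W', (U : W'.Opens)) Γ(Z, g ⁻¹ᵁ (U : W'.Opens)) := (g.app U).hom.toAlgebra
  have halg : ∀ s, algebraMap Γ(W', (U : W'.Opens)) Γ(Z, g ⁻¹ᵁ (U : W'.Opens)) s = g.app U s :=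
    fun s => rfl
  haveI : Algebra.IsIntegral Γ(W', (U : W'.Opens)) Γ(Z, g ⁻¹ᵁ (U : W'.Opens)) := ⟨fun z => hint z⟩
  haveI : IsIntegrallyClosed Γ(Z, g ⁻¹ᵁ (U : W'.Opens)) := hic
  have hinj' : Function.Injective (algebraMap Γ(W', (U : W'.Opens)) Γ(Z, g ⁻¹ᵁ (U : W'.Opens))) :=
    hinj
  haveI : CharP Γ(W', (U : W'.Opens)) p :=
    charP_of_injective_ringHom ((Scheme.ΓSpecIso (.of k)).inv ≫ f'.appLE ⊤ U le_top).hom.injective p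
  haveI : CharP Γ(Z, g ⁻¹ᵁ (U : W'.Opens)) p := charP_of_injective_ringHom hinj' p
  have ht' : t ^ p = algebraMap _ _ aU := ht
  have hbir' : ∀ z : Γ(Z, g ⁻¹ᵁ (U : W'.Opens)), ∃ d : Γ(W', (U : W'.Opens)), d ≠ 0 ∧
      ∃ P : Γ(W', (U : W'.Opens))[X], algebraMap _ _ d * z = aeval t P := by
    intro z; obtain ⟨d, hd, P, hP⟩ := hbir z; refine ⟨d, hd, P, ?_⟩; rw [aeval_def]; exact hP
  -- the Kummer chart
  obtain ⟨Φ, hΦ⟩ := exists_kummerChart p hinj' xs' hxs0 Aexp j₀ c₀ hc₀ aU gs u₁ hu₁ hA' t ht'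
  -- data along `E`
  have hDE : ∀ j, (D j).1 ∈ E := fun j => (D j).2.1
  have hDinj : Function.Injective (fun j => (D j).1) := fun i j h => hDbij.1 (Subtype.ext h)
  -- the centre as a localization of `A`
  letI := W'.presheaf.algebra_section_stalk (⟨w, hwU⟩ : (U : W'.Opens))
  haveI := U.2.isLocalization_stalk ⟨w, hwU⟩
  have hmem𝔮 : ∀ (w' : W') (hw' : w' ∈ (U : W'.Opens)) (s : Γ(W', (U : W'.Opens))),
      s ∈ (U.2.primeIdealOf ⟨w', hw'⟩).asIdeal ↔
        ¬ IsUnit (W'.presheaf.germ (U : W'.Opens) w' hw' s) := by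
    intro w' hw' s
    letI := W'.presheaf.algebra_section_stalk (⟨w', hw'⟩ : (U : W'.Opens))
    haveI := U.2.isLocalization_stalk ⟨w', hw'⟩
    rw [← IsLocalization.AtPrime.to_map_mem_maximal_iff (W'.presheaf.stalk w')
        (U.2.primeIdealOf ⟨w', hw'⟩).asIdeal s,
      IsLocalRing.mem_maximalIdeal, mem_nonunits_iff]
    rfl
  obtain ⟨hxm', hli₀⟩ := hli_of_hasSNC hE w D hDbij.1
    (fun j => W'.presheaf.germ (U : W'.Opens) w hwU (xs' j))
    fun j => stalkIdeal_eq_span_germ_of_spread (D := fun j => (D j).1) hB1' hwU j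
  have hx₀ : ∀ j, xs' j ∈ (U.2.primeIdealOf ⟨w, hwU⟩).asIdeal := fun j =>
    (hmem𝔮 w hwU _).mpr fun hu => (IsLocalRing.mem_maximalIdeal _).mp (hxm' j) hu
  -- Kato's condition and the stalk monoid at every point of `V`, via the local model
  have perPoint : ∀ (y' : Z) (hy' : y' ∈ g ⁻¹ᵁ (U : W'.Opens)) (N : Type) [CommRing N]
      [Algebra Γ(Z, g ⁻¹ᵁ (U : W'.Opens)) N]
      [IsLocalization.AtPrime N (hVaff.primeIdealOf ⟨y', hy'⟩).asIdeal],
      LogChart.IsLogRegularLocal (kummerCone p j₀ (fun j => c₀ * Aexp j % p))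
        ((algebraMap Γ(Z, g ⁻¹ᵁ (U : W'.Opens)) N).toMonoidHom.comp Φ) ∧
      ∀ σN : W'.presheaf.stalk (g.base y') →+* N,
        σN.comp (W'.presheaf.germ (U : W'.Opens) (g.base y') hy').hom =
          (algebraMap Γ(Z, g ⁻¹ᵁ (U : W'.Opens)) N).comp (algebraMap Γ(W', (U : W'.Opens)) _) →
        divisorialMonoid
            (Ideal.span {σN (W'.presheaf.germ (U : W'.Opens) (g.base y') hy' (∏ j, xs' j))}) =
          IsUnit.submonoid N ⊔
            MonoidHom.mrange ((algebraMap Γ(Z, g ⁻¹ᵁ (U : W'.Opens)) N).toMonoidHom.comp Φ) := by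
    intro y' hy' N _ _ _
    have hw'U : g.base y' ∈ (U : W'.Opens) := hy'
    letI := W'.presheaf.algebra_section_stalk (⟨g.base y', hw'U⟩ : (U : W'.Opens))
    haveI := U.2.isLocalization_stalk ⟨g.base y', hw'U⟩
    haveI : IsRegularLocalRing (W'.presheaf.stalk (g.base y')) := hreg _
    have hcomap : ((hVaff.primeIdealOf ⟨y', hy'⟩).asIdeal).comap
        (algebraMap Γ(W', (U : W'.Opens)) Γ(Z, g ⁻¹ᵁ (U : W'.Opens))) =
        (U.2.primeIdealOf ⟨g.base y', hw'U⟩).asIdeal := by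
      ext s
      rw [Ideal.mem_comap, halg, ← Scheme.Hom.appLE_eq_app]
      exact mem_primeIdealOf_iff_of_stalkMap g U.2 hVaff le_rfl y' hy' s
    haveI : IsLocalization.AtPrime (W'.presheaf.stalk (g.base y'))
        (((hVaff.primeIdealOf ⟨y', hy'⟩).asIdeal).comap
          (algebraMap Γ(W', (U : W'.Opens)) Γ(Z, g ⁻¹ᵁ (U : W'.Opens)))) :=
      isLocalization_atPrime_of_eq _ _ hcomap
    have hmem' : ∀ s : Γ(W', (U : W'.Opens)), s ∈ ((hVaff.primeIdealOf ⟨y', hy'⟩).asIdeal).comap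
        (algebraMap Γ(W', (U : W'.Opens)) Γ(Z, g ⁻¹ᵁ (U : W'.Opens))) ↔
        ¬ IsUnit (W'.presheaf.germ (U : W'.Opens) (g.base y') hw'U s) := fun s => by
      rw [hcomap]; exact hmem𝔮 _ hw'U s
    have key := localChart_pointwise_kummer (O₀ := W'.presheaf.stalk w)
      (O := W'.presheaf.stalk (g.base y')) (N := N) p xs' Aexp j₀ c₀ hc₀ aU gs u₁ hu₁ hA' hprime'
      hinj' t ht' hbir' Φ hΦ (U.2.primeIdealOf ⟨w, hwU⟩).asIdeal hx₀ hli₀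
      (hVaff.primeIdealOf ⟨y', hy'⟩).asIdeal
      (fun s σ hσ hmem => (hli_of_spread (D := fun j => (D j).1) hDE hDinj hB1' hw'U hE σ hσ
        fun i => (hmem' (xs' (σ i))).mp (hmem i)).2)
      (fun s σ hσ hJ => pointData_giraudNormalFormAt_of_pointwise hDE hDinj hB1' hB2 hw'U aU
        (hG' _ hw'U) σ hσ fun j => (hmem' (xs' j)).symm.trans (hJ j))
    exact ⟨key.1, fun σN hσN => key.2 σN hσN⟩
  -- the chart record
  refine ⟨⟨⟨g ⁻¹ᵁ (U : W'.Opens), hVaff⟩, hyV, r, kummerCone p j₀ (fun j => c₀ * Aexp j % p), Φ,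
    kummerCone_fg hp.pos j₀ _, kummerCone_saturated p j₀ _, span_kummerCone_eq_top p j₀ _,
    fun 𝔓 _ => ?_, fun y' hy' => ?_⟩⟩
  · -- Kato's condition at `𝔓`
    obtain ⟨⟨y', hy'⟩, hy'𝔓⟩ := exists_point_of_prime hVaff 𝔓
    have h𝔓 : (hVaff.primeIdealOf ⟨y', hy'⟩).asIdeal = 𝔓 := by rw [hy'𝔓]
    haveI : IsLocalization.AtPrime (Localization.AtPrime 𝔓) (hVaff.primeIdealOf ⟨y', hy'⟩).asIdeal :=
      isLocalization_atPrime_of_eq _ _ h𝔓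
    rw [LogChart.isLogRegularAt_iff_isLogRegularLocal]
    exact (perPoint y' hy' (Localization.AtPrime 𝔓)).1
  · -- the stalk monoid at `y'`
    letI := Z.presheaf.algebra_section_stalk (⟨y', hy'⟩ : g ⁻¹ᵁ (U : W'.Opens))
    haveI := hVaff.isLocalization_stalk ⟨y', hy'⟩
    have hσN : (g.stalkMap y').hom.comp (W'.presheaf.germ (U : W'.Opens) (g.base y') hy').hom =
        (algebraMap Γ(Z, g ⁻¹ᵁ (U : W'.Opens)) (Z.presheaf.stalk y')).comp
          (algebraMap Γ(W', (U : W'.Opens)) _) := by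
      have := Scheme.Hom.germ_stalkMap g (U : W'.Opens) y' hy'
      rw [← CommRingCat.hom_comp, this, CommRingCat.hom_comp]
      rfl
    have key := (perPoint y' hy' (Z.presheaf.stalk y')).2 (g.stalkMap y').hom hσN
    change chartStalkMonoid _ Φ y' hy' =
      divisorialMonoid (((E.map fun D => stalkIdeal D (g.base y')).prod).map (g.stalkMap y').hom)
    rw [pointData_divisorialMonoid (D := fun j => (D j).1) hDE hB1' hB2 hy' (g.stalkMap y').hom, key,
      chartStalkMonoid, MonoidHom.map_mrange]
    rfl

end Summit.ResolutionOfSingularities.ResolutionOfSingularities.Theorems.Picover.LocalChartSepKummerCentre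

end
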